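import Literature.NumberTheory.Automorphic.GLnAdelicMatrixModel
import Literature.NumberTheory.Automorphic.MatrixTwoConjugacy
import Literature.NumberTheory.Automorphic.QuaternionUnitsTraceClasses
import Literature.NumberTheory.Automorphic.AdelicGroupDataGLnProofs
import Mathlib.Topology.Algebra.Group.OpenMapping
import HarnessLib

/-!
# The elliptic tori of `GL(2)` over the adeles: `C_{GL₂(𝔸_K)}(γ) ≅ E_𝔸ˣ`, `E = K(γ)`
(Gelbart, *Automorphic forms on adele groups* (1975), p. 150, pp. 154–155: `B_𝔸 = B_𝔸(E)`, the
centraliser of the quadratic extension `E` in `G_𝔸 = GL(2, 𝔸)`, and `meas(Z_𝔸 B_F \ B_𝔸)` in (10.15),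
(10.18); Jacquet–Langlands, LNM 114, §16)

Topic `NumberTheory/Automorphic`. Definitions (`ScalarExtension.subalgebraToMatrix`,
`glTwoTorusMap`, `glTwoTorusHom`, `glTwoTorusEquiv`, `glTwoDatumTorusEquiv`) and theorems; no
named fact, no instance. The `GL(2)` twin of `QuaternionAdelicTorus` /
`QuaternionTorusCentralizer`: there, for a regular `γ'` of a division quaternion algebra `D`, the
centraliser `C_{D_𝔸ˣ}(γ')` was identified with the idele group `T_𝔸ˣ` of the quadratic field
`T = K(γ') = C_D(γ')`; here the same is done for a non-scalar `γ ∈ GL₂(K)` inside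
`GL₂(𝔸_K) = (AdelicGroupData.gl 2 K).Adelic`, with `E = C_{M₂(K)}(γ) = K[γ]`
(`centralizer_singleton_eq_adjoin_of_not_mem_bot`), a quadratic field when `γ` is elliptic.

* `ScalarExtension.subalgebraToMatrix K R E : R ⊗_K E →ₐ[R] M_n(R)` for a subalgebra `E ≤ M_n(K)`
  (`mapRight E.val` followed by the model isomorphism `matrixAlgEquiv`), injective
  (`subalgebraToMatrix_injective`, flatness over `K`), continuous, `1 ⊗ e ↦ e`;
* `exists_isUnit_det_conj_map_eq_companion` — a non-scalar `γ ∈ M₂(K)` stays conjugate to its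
  companion matrix over any commutative `K`-algebra `R`; hence (`MatrixTwoConjugacy`) the commutant
  of `γ` in `M₂(R)` is `R · 1 + R · γ` = the image of `R ⊗_K E`
  (`mem_range_subalgebraToMatrix_iff`: `B ∈ im(R ⊗ E) ↔ γ B = B γ`);
* `glTwoTorusMap K γ : E_𝔸ˣ →* GL₂(𝔸_K)` (units of `subalgebraToMatrix` over `R = 𝔸_K`), injective,
  continuous, `glTwoTorusMap (1 ⊗ e) = e ∈ GL₂(K)`, `glTwoTorusMap (posRealCentral t) = posRealScalar 2 K t`,
  and **`range_glTwoTorusMap_eq_centralizer`: its image is `C_{GL₂(𝔸_K)}(γ)`** (a unit commuting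
  with `γ` lies in `𝔸 · 1 + 𝔸 · γ` together with its inverse; lift by injectivity) — Gelbart's
  `B_𝔸(E)`;
* `glTwoTorusHom`, `glTwoTorusEquiv K γ hγ : E_𝔸ˣ ≃ₜ* C_{GL₂(𝔸_K)}(γ)` — a continuous bijective
  homomorphism from the σ-compact `E_𝔸ˣ` onto the closed subgroup `C(γ)` of the locally compact
  `GL₂(𝔸_K)` is open (Mathlib `MonoidHom.isOpenMap_of_sigmaCompact`); keyed on the data as
  `glTwoDatumTorusEquiv : (units K E).Adelic ≃ₜ* C_{(gl 2 K).Adelic}((gl 2 K).toAdelic γ)`;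
  `glTwo_adelic_centralizer_comm`: `C(γ)` is abelian;
* `glTwoTorusMap_mem_quotientSubgroup_iff` — **`w ∈ ℝ_{>0} Eˣ ↔ glTwoTorusMap w ∈ ℝ_{>0} GL₂(K)`**
  (central retraction of `GL₂(𝔸_K)`, `exists_centralRetraction_gl`; a rational unit commuting with
  `γ` lies in `Eˣ`, `glTwo_centralizer_singleton_eq`), so the torus isomorphism carries
  `ℝ_{>0} Eˣ` onto `ℝ_{>0} GL₂(K) ∩ C(γ)` (`glTwoDatumTorusEquiv_mem_iff`);
* `compactSpace_glTwo_centralizer_quotient` — for **elliptic** `γ` (irreducible characteristic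
  polynomial, so `E` is a field) `C(γ) ⧸ (ℝ_{>0} GL₂(K) ∩ C(γ))` is compact: the continuous image
  of `E_𝔸ˣ ⧸ ℝ_{>0} Eˣ`, compact by Fujisaki's lemma for the field `E`
  (`compactSpace_automorphicQuotient_units_of_forall_isUnit`). This is the finiteness of the
  volumes `meas(Z_𝔸 B_F \ B_𝔸)` of the elliptic terms of (10.15) (Gelbart p. 155).

A brick of the inline (D-0026) decomposition of
`Literature.NumberTheory.Automorphic.strong_multiplicity_one_quaternionUnits` (Gelbart Thm. 10.5):
in the comparison (10.14) = (10.15) the elliptic terms on both sides are indexed by the quadratic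
fields `E` with `E_v` a field for `v ∈ Ram(D)`, and their volume factors are the covolumes of
`ℝ_{>0} Eˣ` in `E_𝔸ˣ` on *both* sides — on the `D^×` side by `QuaternionTorusCentralizer`, on the
`GL(2)` side by the torus isomorphism of this file.

## References

* S. Gelbart, *Automorphic forms on adele groups*, Ann. of Math. Studies 83 (1975), p. 150,
  pp. 154–155 [Gelbart1975].
* H. Jacquet, R. P. Langlands, *Automorphic forms on GL(2)*, LNM 114 (1970), §16
  [JacquetLanglands1970].
-/

noncomputable section

open scoped TensorProduct NNReal
open NumberField IsDedekindDomain Matrix Topology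

namespace Literature.NumberTheory.Automorphic

/-! ### `R ⊗_K E → M_n(R)` for a subalgebra `E ≤ M_n(K)` -/

section SubalgebraToMatrix

variable (K : Type*) [Field K] (R : Type*) [CommRing R] [Algebra K R]
  {n : Type*} [Fintype n] [DecidableEq n] (E : Subalgebra K (Matrix n n K))

/-- **The realisation of `R ⊗_K E` inside `M_n(R)`** for a subalgebra `E ≤ M_n(K)`: `r ⊗ e ↦ r • e`
(`mapRight E.val : R ⊗ E → R ⊗ M_n(K)` followed by `matrixAlgEquiv : R ⊗ M_n(K) ≃ M_n(R)`). For
`E = K(γ)` and `R = 𝔸_K` this is the inclusion of the adelic torus `E_𝔸 ↪ M₂(𝔸)` (Gelbart (1975),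
p. 154: `B_𝔸(E)`). [folklore] -/
def ScalarExtension.subalgebraToMatrix : ScalarExtension K R E →ₐ[R] Matrix n n R :=
  (ScalarExtension.matrixAlgEquiv K R n).toAlgHom.comp (ScalarExtension.mapRight K R E.val)

/-- `subalgebraToMatrix (z) = matrixAlgEquiv (mapRight E.val z)` (definitional). [folklore] -/
theorem ScalarExtension.subalgebraToMatrix_apply (z : ScalarExtension K R E) :
    ScalarExtension.subalgebraToMatrix K R E z =
      ScalarExtension.matrixAlgEquiv K R n (ScalarExtension.mapRight K R E.val z) := rfl

/-- `subalgebraToMatrix (r ⊗ e) = r • e` (entries mapped into `R`). [folklore] -/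
theorem ScalarExtension.subalgebraToMatrix_tmul (r : R) (e : E) :
    ScalarExtension.subalgebraToMatrix K R E (ScalarExtension.ofTensor K R E (r ⊗ₜ[K] e)) =
      r • (e : Matrix n n K).map (algebraMap K R) := by
  rw [ScalarExtension.subalgebraToMatrix_apply, ScalarExtension.mapRight_tmul,
    ScalarExtension.matrixAlgEquiv_tmul]
  rfl

/-- `subalgebraToMatrix (1 ⊗ e) = e`: compatibility with the diagonal embeddings. [folklore] -/
@[simp]
theorem ScalarExtension.subalgebraToMatrix_incl (e : E) :
    ScalarExtension.subalgebraToMatrix K R E (ScalarExtension.incl K R E e) =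
      (e : Matrix n n K).map (algebraMap K R) := by
  rw [ScalarExtension.subalgebraToMatrix_apply, ScalarExtension.mapRight_incl,
    ScalarExtension.matrixAlgEquiv_incl]
  rfl

/-- `subalgebraToMatrix` maps the scalar `r` to the scalar matrix. [folklore] -/
theorem ScalarExtension.subalgebraToMatrix_algebraMap (r : R) :
    ScalarExtension.subalgebraToMatrix K R E (algebraMap R (ScalarExtension K R E) r) =
      algebraMap R (Matrix n n R) r :=
  AlgHom.commutes _ r

/-- `subalgebraToMatrix` is injective (`mapRight E.val` is, by flatness over the field `K`).
[folklore] -/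
theorem ScalarExtension.subalgebraToMatrix_injective :
    Function.Injective (ScalarExtension.subalgebraToMatrix K R E) :=
  (ScalarExtension.matrixAlgEquiv K R n).injective.comp
    (ScalarExtension.mapRight_injective K R E.val Subtype.val_injective)

/-- `subalgebraToMatrix` is continuous for the module topology on `R ⊗ E` and the entrywise topology
on `M_n(R)`. [folklore] -/
theorem ScalarExtension.continuous_subalgebraToMatrix [TopologicalSpace R] [IsTopologicalRing R] :
    Continuous (ScalarExtension.subalgebraToMatrix K R E) :=
  (ScalarExtension.continuous_matrixAlgEquiv K R n).comp (ScalarExtension.continuous_mapRight K R E.val)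

end SubalgebraToMatrix

/-! ### The commutant of a non-scalar `γ ∈ M₂(K)` over a `K`-algebra `R` is the image of `R ⊗ K[γ]` -/

section Commutant

variable (K : Type*) [Field K] (R : Type*) [CommRing R] [Algebra K R]

omit [Algebra K R] in
/-- `(a • 1 + b • A).map f = f a • 1 + f b • A.map f` for a ring map `f`. [folklore] -/
theorem map_smul_one_add_smul (f : K →+* R) (a b : K) (A : Matrix (Fin 2) (Fin 2) K) :
    (a • (1 : Matrix (Fin 2) (Fin 2) K) + b • A).map f =
      f a • (1 : Matrix (Fin 2) (Fin 2) R) + f b • A.map f := by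
  ext i j
  fin_cases i <;> fin_cases j <;> simp

/-- **A non-scalar `γ ∈ M₂(K)` stays conjugate to its companion matrix over every commutative
`K`-algebra `R`**: `P⁻¹ γ_R P = !![0, -det γ; 1, tr γ]` with `det P` a unit of `R` (base change of
the rational canonical form `exists_conj_eq_companion`). [folklore] -/
theorem exists_isUnit_det_conj_map_eq_companion {A : Matrix (Fin 2) (Fin 2) K}
    (hA : A ∉ (⊥ : Subalgebra K (Matrix (Fin 2) (Fin 2) K))) :
    ∃ P : Matrix (Fin 2) (Fin 2) R, IsUnit P.det ∧
      P⁻¹ * A.map (algebraMap K R) * P =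
        !![0, -(algebraMap K R A.det); 1, algebraMap K R A.trace] := by
  obtain ⟨P₀, hP₀, hmul, -⟩ := exists_conj_eq_companion hA
  have hdet : IsUnit (P₀.map (algebraMap K R)).det := by
    have h : (P₀.map (algebraMap K R)).det = algebraMap K R P₀.det :=
      (RingHom.map_det (algebraMap K R) P₀).symm
    rw [h]
    exact (isUnit_iff_ne_zero.mpr hP₀).map _
  refine ⟨P₀.map (algebraMap K R), hdet, ?_⟩
  · refine inv_mul_mul_eq_of_mul_eq_mul hdet ?_
    · have h := congrArg (fun M : Matrix (Fin 2) (Fin 2) K => M.map (algebraMap K R)) hmul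
      simp only [Matrix.map_mul] at h
      rw [h]
      congr 1
      ext i j
      fin_cases i <;> fin_cases j <;> simp

variable {K R} in
/-- An element of `C(γ) ≤ M₂(K)` is `a • 1 + b • γ` for a non-scalar `γ`. [folklore] -/
theorem exists_coe_eq_of_mem_centralizer {A : Matrix (Fin 2) (Fin 2) K}
    (hA : A ∉ (⊥ : Subalgebra K (Matrix (Fin 2) (Fin 2) K)))
    (e : Subalgebra.centralizer K ({A} : Set (Matrix (Fin 2) (Fin 2) K))) :
    ∃ a b : K, (e : Matrix (Fin 2) (Fin 2) K) = a • (1 : Matrix (Fin 2) (Fin 2) K) + b • A :=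
  (commute_iff_exists_of_not_mem_bot hA _).1 ((Subalgebra.mem_centralizer_iff K).1 e.2 A rfl)

variable {K R} in
/-- `C(γ)` is commutative for a non-scalar `γ ∈ M₂(K)` (it is `K[γ]`). [folklore] -/
theorem centralizer_comm_of_not_mem_bot {A : Matrix (Fin 2) (Fin 2) K}
    (hA : A ∉ (⊥ : Subalgebra K (Matrix (Fin 2) (Fin 2) K))) :
    ∀ x ∈ Subalgebra.centralizer K ({A} : Set (Matrix (Fin 2) (Fin 2) K)),
      ∀ y ∈ Subalgebra.centralizer K ({A} : Set (Matrix (Fin 2) (Fin 2) K)), x * y = y * x := by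
  rw [centralizer_singleton_eq_adjoin_of_not_mem_bot hA]
  exact Algebra.adjoin_singleton_comm (K := K) A

/-- **The image of `R ⊗_K C(γ)` in `M₂(R)` is `R · 1 + R · γ`**, for a non-scalar `γ ∈ M₂(K)`.
[folklore] -/
theorem exists_subalgebraToMatrix_eq {A : Matrix (Fin 2) (Fin 2) K}
    (hA : A ∉ (⊥ : Subalgebra K (Matrix (Fin 2) (Fin 2) K)))
    (z : ScalarExtension K R (Subalgebra.centralizer K ({A} : Set (Matrix (Fin 2) (Fin 2) K)))) :
    ∃ p r : R, ScalarExtension.subalgebraToMatrix K R _ z =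
      p • (1 : Matrix (Fin 2) (Fin 2) R) + r • A.map (algebraMap K R) := by
  change ∃ p r : R, ScalarExtension.subalgebraToMatrix K R _
    (ScalarExtension.ofTensor K R _ (show R ⊗[K] _ from z)) = _
  generalize (show R ⊗[K] (Subalgebra.centralizer K ({A} : Set (Matrix (Fin 2) (Fin 2) K))) from z) = z'
  induction z' using TensorProduct.induction_on with
  | zero => exact ⟨0, 0, by simp⟩
  | tmul r e =>
    obtain ⟨a, b, hab⟩ := exists_coe_eq_of_mem_centralizer hA e
    refine ⟨r * algebraMap K R a, r * algebraMap K R b, ?_⟩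
    rw [ScalarExtension.subalgebraToMatrix_tmul, hab, map_smul_one_add_smul, smul_add, smul_smul,
      smul_smul]
  | add x y hx hy =>
    obtain ⟨p, r, hp⟩ := hx
    obtain ⟨p', r', hp'⟩ := hy
    refine ⟨p + p', r + r', ?_⟩
    simp only [map_add]
    rw [hp, hp', add_smul, add_smul]
    abel

/-- `p • 1 + r • γ_R` is the image of `p ⊗ 1 + r ⊗ γ ∈ R ⊗ C(γ)`. [folklore] -/
theorem smul_one_add_smul_mem_range_subalgebraToMatrix (A : Matrix (Fin 2) (Fin 2) K) (p r : R) :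
    p • (1 : Matrix (Fin 2) (Fin 2) R) + r • A.map (algebraMap K R) ∈
      (ScalarExtension.subalgebraToMatrix K R
        (Subalgebra.centralizer K ({A} : Set (Matrix (Fin 2) (Fin 2) K)))).range := by
  have hA : A ∈ Subalgebra.centralizer K ({A} : Set (Matrix (Fin 2) (Fin 2) K)) :=
    (Subalgebra.mem_centralizer_iff K).2 fun g hg => by rw [Set.mem_singleton_iff] at hg; subst hg; rfl
  rw [AlgHom.mem_range]
  refine ⟨ScalarExtension.ofTensor K R _ (p ⊗ₜ[K] (1 : Subalgebra.centralizer K ({A} : Set _))) +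
    ScalarExtension.ofTensor K R _ (r ⊗ₜ[K] (⟨A, hA⟩ : Subalgebra.centralizer K ({A} : Set _))), ?_⟩
  rw [map_add, ScalarExtension.subalgebraToMatrix_tmul, ScalarExtension.subalgebraToMatrix_tmul]
  simp [Matrix.map_one (algebraMap K R) (map_zero _) (map_one _)]

/-- **The commutant of a non-scalar `γ ∈ M₂(K)` in `M₂(R)` is the image of `R ⊗_K C(γ)`**
(`R` non-trivial): `B ∈ im(R ⊗ K[γ]) ↔ γ B = B γ` — over `R = 𝔸_K` this is Gelbart's
`B_𝔸(E) = E ⊗ 𝔸` at the level of algebras (p. 154). [cite: Gelbart1975, p. 154] -/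
theorem mem_range_subalgebraToMatrix_iff [Nontrivial R] {A : Matrix (Fin 2) (Fin 2) K}
    (hA : A ∉ (⊥ : Subalgebra K (Matrix (Fin 2) (Fin 2) K))) (B : Matrix (Fin 2) (Fin 2) R) :
    B ∈ (ScalarExtension.subalgebraToMatrix K R
        (Subalgebra.centralizer K ({A} : Set (Matrix (Fin 2) (Fin 2) K)))).range ↔
      A.map (algebraMap K R) * B = B * A.map (algebraMap K R) := by
  constructor
  · intro hB
    obtain ⟨z, rfl⟩ := (AlgHom.mem_range _).1 hB
    obtain ⟨p, r, h⟩ := exists_subalgebraToMatrix_eq K R hA z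
    rw [h]
    exact smul_one_add_smul_mul_comm _ p r
  · intro hB
    obtain ⟨P, hP, hPA⟩ := exists_isUnit_det_conj_map_eq_companion K R hA
    obtain ⟨p, r, rfl⟩ := exists_eq_smul_one_add_smul_of_commute_of_conj_companion hP hPA hB
    exact smul_one_add_smul_mem_range_subalgebraToMatrix K R A p r

end Commutant

/-! ### The torus `E_𝔸ˣ →* GL₂(𝔸_K)` and its image `C_{GL₂(𝔸_K)}(γ)` -/

section Torus

variable (K : Type) [Field K] [NumberField K] (γ : GL (Fin 2) K)

/-- `E = C_{M₂(K)}(γ)`, the quadratic algebra of `γ` (a field when `γ` is elliptic). -/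
local notation "Eγ" => Subalgebra.centralizer K ({(γ : Matrix (Fin 2) (Fin 2) K)} :
  Set (Matrix (Fin 2) (Fin 2) K))

/-- `γ` diagonally embedded in `GL₂(𝔸_K)` (`= (AdelicGroupData.gl 2 K).toAdelic γ`). -/
local notation "γ𝔸" => Matrix.GeneralLinearGroup.map (algebraMap K (AdeleRing (𝓞 K) K)) γ

/-- `𝔸_K` is a non-trivial ring. [folklore] -/
theorem nontrivial_adeleRing : Nontrivial (AdeleRing (𝓞 K) K) :=
  inferInstanceAs (Nontrivial (InfiniteAdeleRing K × FiniteAdeleRing (𝓞 K) K))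

/-- **The adelic torus of `γ` in `GL₂(𝔸_K)`**: the homomorphism `E_𝔸ˣ = (𝔸_K ⊗_K E)ˣ →* GL₂(𝔸_K)`,
`E = C_{M₂(K)}(γ)`, given by the units of `subalgebraToMatrix` — concretely
`glAdelicUnitsEquiv ∘ unitsMapRight E.val` (the tensor-model inclusion `E_𝔸ˣ → (𝔸 ⊗ M₂(K))ˣ` of
`QuaternionAdelicTorus` followed by the model isomorphism of `GLnAdelicMatrixModel`). Gelbart
(1975), p. 154: `B_𝔸(E) ≤ G_𝔸`. [cite: Gelbart1975, p. 154] -/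
def glTwoTorusMap : adelicUnits K Eγ →* GL (Fin 2) (AdeleRing (𝓞 K) K) :=
  (glAdelicUnitsEquiv K 2).toMonoidHom.comp (unitsMapRight K (Matrix (Fin 2) (Fin 2) K) (Eγ).val)

/-- On underlying matrices `glTwoTorusMap γ w = subalgebraToMatrix w` (definitional). [folklore] -/
theorem coe_glTwoTorusMap (w : adelicUnits K Eγ) :
    ((glTwoTorusMap K γ w : GL (Fin 2) (AdeleRing (𝓞 K) K)) : Matrix (Fin 2) (Fin 2) (AdeleRing (𝓞 K) K)) =
      ScalarExtension.subalgebraToMatrix K (AdeleRing (𝓞 K) K) Eγ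
        ((w : adelicUnits K Eγ) : ScalarExtension K (AdeleRing (𝓞 K) K) Eγ) := rfl

/-- `glTwoTorusMap γ` is injective. [folklore] -/
theorem glTwoTorusMap_injective : Function.Injective (glTwoTorusMap K γ) :=
  (glAdelicUnitsEquiv K 2).injective.comp
    (Units.map_injective (f := (ScalarExtension.mapRight K (AdeleRing (𝓞 K) K) (Eγ).val).toRingHom.toMonoidHom)
      (ScalarExtension.mapRight_injective K (AdeleRing (𝓞 K) K) (Eγ).val Subtype.val_injective))

/-- `glTwoTorusMap γ` is continuous. [folklore] -/
theorem continuous_glTwoTorusMap : Continuous (glTwoTorusMap K γ) :=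
  (glAdelicUnitsEquiv K 2).continuous.comp (continuous_unitsMapRight K _ _)

/-- **Compatibility with the rational points**: `glTwoTorusMap γ (1 ⊗ e) = e` for `e ∈ Eˣ`, where
`e` is read in `GL₂(K)` through `E ≤ M₂(K)` and embedded diagonally in `GL₂(𝔸_K)`
(`B_F(E) ≤ G_F`, Gelbart p. 154). [folklore] -/
theorem glTwoTorusMap_inclAdelic (e : (Eγ)ˣ) :
    glTwoTorusMap K γ (inclAdelic K _ e) =
      Matrix.GeneralLinearGroup.map (algebraMap K (AdeleRing (𝓞 K) K))
        (Units.map (Eγ).val.toRingHom.toMonoidHom e) := by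
  change glAdelicUnitsEquiv K 2 (unitsMapRight K (Matrix (Fin 2) (Fin 2) K) _ (inclAdelic K _ e)) = _
  rw [unitsMapRight_inclAdelic, glAdelicUnitsEquiv_inclAdelic]

/-- **Compatibility with the split centre**: `glTwoTorusMap γ (posRealCentral t) = posRealScalar 2 K t`.
[folklore] -/
theorem glTwoTorusMap_posRealCentral (t : ℝ≥0ˣ) :
    glTwoTorusMap K γ (posRealCentral K _ t) = posRealScalar 2 K t := by
  change glAdelicUnitsEquiv K 2 (unitsMapRight K (Matrix (Fin 2) (Fin 2) K) _ (posRealCentral K _ t)) = _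
  rw [unitsMapRight_posRealCentral, glAdelicUnitsEquiv_posRealCentral]

/-- The image of the torus commutes with `γ`. [folklore] -/
theorem glTwoTorusMap_mul_comm
    (hγ : (γ : Matrix (Fin 2) (Fin 2) K) ∉ (⊥ : Subalgebra K (Matrix (Fin 2) (Fin 2) K)))
    (w : adelicUnits K Eγ) :
    γ𝔸 * glTwoTorusMap K γ w = glTwoTorusMap K γ w * γ𝔸 := by
  haveI := nontrivial_adeleRing K
  refine Units.ext ?_
  rw [Units.val_mul, Units.val_mul, coe_glTwoTorusMap]
  exact (mem_range_subalgebraToMatrix_iff K (AdeleRing (𝓞 K) K) hγ _).1 ⟨_, rfl⟩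

/-- **The image of the adelic torus is the centraliser: `im(E_𝔸ˣ → GL₂(𝔸_K)) = C_{GL₂(𝔸_K)}(γ)`**
for a non-scalar `γ ∈ GL₂(K)` (Gelbart (1975), p. 154: `B_𝔸 = B_𝔸(E)` is the centraliser of `E`
in `G_𝔸`). A unit `g` commuting with `γ` lies, with its inverse, in the commutant
`𝔸 · 1 + 𝔸 · γ = im(𝔸 ⊗ E)` (`mem_range_subalgebraToMatrix_iff`); by injectivity the two preimages
are inverse to each other, so `g` comes from a unit of `𝔸 ⊗ E`. [cite: Gelbart1975, p. 154] -/
theorem range_glTwoTorusMap_eq_centralizer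
    (hγ : (γ : Matrix (Fin 2) (Fin 2) K) ∉ (⊥ : Subalgebra K (Matrix (Fin 2) (Fin 2) K))) :
    (glTwoTorusMap K γ).range =
      Subgroup.centralizer ({γ𝔸} : Set (GL (Fin 2) (AdeleRing (𝓞 K) K))) := by
  haveI := nontrivial_adeleRing K
  apply le_antisymm
  · rintro _ ⟨w, rfl⟩
    rw [Subgroup.mem_centralizer_iff]
    simp only [Set.mem_singleton_iff, forall_eq]
    exact glTwoTorusMap_mul_comm K γ hγ w
  · intro g hg
    rw [Subgroup.mem_centralizer_iff] at hg
    simp only [Set.mem_singleton_iff, forall_eq] at hg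
    -- `g` and `g⁻¹` commute with `γ`, hence lie in the image of `𝔸 ⊗ E`
    have hg' : γ𝔸 * g⁻¹ = g⁻¹ * γ𝔸 := by
      calc γ𝔸 * g⁻¹ = g⁻¹ * (g * γ𝔸) * g⁻¹ := by group
        _ = g⁻¹ * (γ𝔸 * g) * g⁻¹ := by rw [hg]
        _ = g⁻¹ * γ𝔸 := by group
    have key : ∀ u : GL (Fin 2) (AdeleRing (𝓞 K) K), γ𝔸 * u = u * γ𝔸 →
        ∃ z, ScalarExtension.subalgebraToMatrix K (AdeleRing (𝓞 K) K) Eγ z =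
          (u : Matrix (Fin 2) (Fin 2) (AdeleRing (𝓞 K) K)) := by
      intro u hu
      have hu' := congrArg Units.val hu
      rw [Units.val_mul, Units.val_mul] at hu'
      exact (AlgHom.mem_range _).1 ((mem_range_subalgebraToMatrix_iff K (AdeleRing (𝓞 K) K) hγ _).2 hu')
    obtain ⟨z, hz⟩ := key g hg
    obtain ⟨z', hz'⟩ := key g⁻¹ hg'
    have hinj := ScalarExtension.subalgebraToMatrix_injective K (AdeleRing (𝓞 K) K) Eγ
    have h1 : z * z' = 1 := hinj (by
      rw [map_mul, map_one, hz, hz', ← Units.val_mul, mul_inv_cancel, Units.val_one])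
    have h2 : z' * z = 1 := hinj (by
      rw [map_mul, map_one, hz, hz', ← Units.val_mul, inv_mul_cancel, Units.val_one])
    exact ⟨⟨z, z', h1, h2⟩, Units.ext hz⟩

/-- **The adelic centraliser of a non-scalar `γ` is abelian** (it is the torus `E_𝔸ˣ`).
[cite: Gelbart1975, p. 154] -/
theorem glTwo_adelic_centralizer_comm
    (hγ : (γ : Matrix (Fin 2) (Fin 2) K) ∉ (⊥ : Subalgebra K (Matrix (Fin 2) (Fin 2) K))) :
    ∀ x ∈ Subgroup.centralizer ({γ𝔸} : Set (GL (Fin 2) (AdeleRing (𝓞 K) K))),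
      ∀ y ∈ Subgroup.centralizer ({γ𝔸} : Set (GL (Fin 2) (AdeleRing (𝓞 K) K))), x * y = y * x := by
  rw [← range_glTwoTorusMap_eq_centralizer K γ hγ]
  rintro _ ⟨w, rfl⟩ _ ⟨w', rfl⟩
  rw [← map_mul, ← map_mul]
  congr 1
  refine Units.ext ?_
  rw [Units.val_mul, Units.val_mul]
  exact ScalarExtension.mul_comm_of_comm K _
    (fun x y => Subtype.ext (centralizer_comm_of_not_mem_bot hγ x x.2 y y.2)) _ _

/-! ### The torus isomorphism `E_𝔸ˣ ≃ₜ* C_{GL₂(𝔸_K)}(γ)` -/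

/-- **The torus homomorphism `E_𝔸ˣ →* C_{GL₂(𝔸_K)}(γ)`** (`glTwoTorusMap` with codomain restricted to
the centraliser, its range). [cite: Gelbart1975, p. 154] -/
def glTwoTorusHom
    (hγ : (γ : Matrix (Fin 2) (Fin 2) K) ∉ (⊥ : Subalgebra K (Matrix (Fin 2) (Fin 2) K))) :
    adelicUnits K Eγ →* Subgroup.centralizer ({γ𝔸} : Set (GL (Fin 2) (AdeleRing (𝓞 K) K))) :=
  (glTwoTorusMap K γ).codRestrict _ fun w => by
    rw [← range_glTwoTorusMap_eq_centralizer K γ hγ]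
    exact ⟨w, rfl⟩

/-- `glTwoTorusHom w = glTwoTorusMap w` on underlying elements (definitional). [folklore] -/
@[simp]
theorem coe_glTwoTorusHom
    (hγ : (γ : Matrix (Fin 2) (Fin 2) K) ∉ (⊥ : Subalgebra K (Matrix (Fin 2) (Fin 2) K)))
    (w : adelicUnits K Eγ) :
    ((glTwoTorusHom K γ hγ w : Subgroup.centralizer ({γ𝔸} : Set (GL (Fin 2) (AdeleRing (𝓞 K) K)))) :
      GL (Fin 2) (AdeleRing (𝓞 K) K)) = glTwoTorusMap K γ w := rfl

/-- `glTwoTorusHom` is bijective. [cite: Gelbart1975, p. 154] -/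
theorem glTwoTorusHom_bijective
    (hγ : (γ : Matrix (Fin 2) (Fin 2) K) ∉ (⊥ : Subalgebra K (Matrix (Fin 2) (Fin 2) K))) :
    Function.Bijective (glTwoTorusHom K γ hγ) := by
  refine ⟨fun a b hab => glTwoTorusMap_injective K γ (congrArg Subtype.val hab), ?_⟩
  rintro ⟨g, hg⟩
  rw [← range_glTwoTorusMap_eq_centralizer K γ hγ] at hg
  obtain ⟨w, rfl⟩ := hg
  exact ⟨w, rfl⟩

/-- `glTwoTorusHom` is continuous. [folklore] -/
theorem continuous_glTwoTorusHom
    (hγ : (γ : Matrix (Fin 2) (Fin 2) K) ∉ (⊥ : Subalgebra K (Matrix (Fin 2) (Fin 2) K))) :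
    Continuous (glTwoTorusHom K γ hγ) :=
  (continuous_glTwoTorusMap K γ).subtype_mk _

/-- `glTwoTorusHom` is an open map (open mapping theorem for the σ-compact `E_𝔸ˣ` onto the closed
subgroup `C(γ)` of the locally compact Hausdorff `GL₂(𝔸_K)`; Mathlib
`MonoidHom.isOpenMap_of_sigmaCompact`). [folklore] -/
theorem isOpenMap_glTwoTorusHom
    (hγ : (γ : Matrix (Fin 2) (Fin 2) K) ∉ (⊥ : Subalgebra K (Matrix (Fin 2) (Fin 2) K))) :
    IsOpenMap (glTwoTorusHom K γ hγ) := by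
  obtain ⟨j₁, j₂, j₃⟩ := units_adelic_topology K Eγ
  haveI : LocallyCompactSpace (adelicUnits K Eγ) := j₁
  haveI : T2Space (adelicUnits K Eγ) := j₂
  haveI : SecondCountableTopology (adelicUnits K Eγ) := j₃
  haveI : LocallyCompactSpace (GL (Fin 2) (AdeleRing (𝓞 K) K)) :=
    AdelicGroupData.locallyCompactSpace_gl_adelic_holds 2 K
  haveI : T2Space (GL (Fin 2) (AdeleRing (𝓞 K) K)) := t2Space_gl 2 K
  haveI : IsClosed ((Subgroup.centralizer ({γ𝔸} : Set (GL (Fin 2) (AdeleRing (𝓞 K) K))) :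
      Subgroup (GL (Fin 2) (AdeleRing (𝓞 K) K))) : Set (GL (Fin 2) (AdeleRing (𝓞 K) K))) :=
    isClosed_centralizer_singleton _
  haveI : LocallyCompactSpace (Subgroup.centralizer ({γ𝔸} : Set (GL (Fin 2) (AdeleRing (𝓞 K) K)))) :=
    ‹IsClosed _›.isClosedEmbedding_subtypeVal.locallyCompactSpace
  exact MonoidHom.isOpenMap_of_sigmaCompact _ (glTwoTorusHom_bijective K γ hγ).2
    (continuous_glTwoTorusHom K γ hγ)

/-- **The adelic torus as a topological group: `E_𝔸ˣ ≃ₜ* C_{GL₂(𝔸_K)}(γ)`** for a non-scalar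
`γ ∈ GL₂(K)`, `E = C_{M₂(K)}(γ) = K[γ]` (Gelbart (1975), p. 154: `B_𝔸(E)`): `glTwoTorusHom` is a
continuous open bijective homomorphism. [cite: Gelbart1975, p. 154] -/
def glTwoTorusEquiv
    (hγ : (γ : Matrix (Fin 2) (Fin 2) K) ∉ (⊥ : Subalgebra K (Matrix (Fin 2) (Fin 2) K))) :
    adelicUnits K Eγ ≃ₜ* Subgroup.centralizer ({γ𝔸} : Set (GL (Fin 2) (AdeleRing (𝓞 K) K))) :=
  { MulEquiv.ofBijective (glTwoTorusHom K γ hγ) (glTwoTorusHom_bijective K γ hγ) with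
    continuous_toFun := continuous_glTwoTorusHom K γ hγ
    continuous_invFun :=
      ((Equiv.ofBijective _ (glTwoTorusHom_bijective K γ hγ)).toHomeomorphOfContinuousOpen
        (continuous_glTwoTorusHom K γ hγ) (isOpenMap_glTwoTorusHom K γ hγ)).continuous_symm }

/-- `glTwoTorusEquiv w = glTwoTorusMap w` on underlying elements (definitional). [folklore] -/
@[simp]
theorem coe_glTwoTorusEquiv
    (hγ : (γ : Matrix (Fin 2) (Fin 2) K) ∉ (⊥ : Subalgebra K (Matrix (Fin 2) (Fin 2) K)))
    (w : adelicUnits K Eγ) :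
    ((glTwoTorusEquiv K γ hγ w : Subgroup.centralizer ({γ𝔸} : Set (GL (Fin 2) (AdeleRing (𝓞 K) K)))) :
      GL (Fin 2) (AdeleRing (𝓞 K) K)) = glTwoTorusMap K γ w := rfl

/-! ### `ℝ_{>0} Eˣ` corresponds to `ℝ_{>0} GL₂(K) ∩ C(γ)` -/

/-- `glTwoTorusMap γ` maps `ℝ_{>0} · Eˣ` into `ℝ_{>0} · GL₂(K)`. [folklore] -/
theorem map_quotientSubgroup_glTwoTorusMap_le :
    ((AdelicGroupData.units K Eγ).quotientSubgroup).map (glTwoTorusMap K γ) ≤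
      (AdelicGroupData.gl 2 K).quotientSubgroup := by
  change ((AdelicGroupData.units K Eγ).quotientSubgroup).map
      ((AdelicGroupData.unitsMatrixEquivGl K 2).toMonoidHom.comp
        (unitsMapRight K (Matrix (Fin 2) (Fin 2) K) (Eγ).val)) ≤ _
  rw [← Subgroup.map_map, ← AdelicGroupData.map_quotientSubgroup_unitsMatrix K 2]
  exact Subgroup.map_mono (map_quotientSubgroup_units_le K (Matrix (Fin 2) (Fin 2) K) _)

omit [NumberField K] in
/-- A rational unit `d ∈ GL₂(K)` commuting with `γ` is a unit of `E = C(γ)`: `d = E.val d'` for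
some `d' ∈ Eˣ`. [folklore] -/
theorem exists_units_centralizer_eq_of_commute (d : GL (Fin 2) K) (h : d * γ = γ * d) :
    ∃ d' : (Eγ)ˣ, Units.map (Eγ).val.toRingHom.toMonoidHom d' = d := by
  have hmem : ∀ g : GL (Fin 2) K, g * γ = γ * g → (g : Matrix (Fin 2) (Fin 2) K) ∈ Eγ := by
    intro g hg
    refine (mem_glTwo_centralizer_iff_coe_mem γ g).1 ?_
    rw [Subgroup.mem_centralizer_iff]
    simp only [Set.mem_singleton_iff, forall_eq]
    exact hg.symm
  have hd := hmem d h
  have hdi : d⁻¹ * γ = γ * d⁻¹ := by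
    calc d⁻¹ * γ = d⁻¹ * (γ * d) * d⁻¹ := by group
      _ = d⁻¹ * (d * γ) * d⁻¹ := by rw [h]
      _ = γ * d⁻¹ := by group
  have hd' := hmem d⁻¹ hdi
  refine ⟨⟨⟨(d : Matrix (Fin 2) (Fin 2) K), hd⟩, ⟨((d⁻¹ : GL (Fin 2) K) : Matrix (Fin 2) (Fin 2) K), hd'⟩,
    Subtype.ext ?_, Subtype.ext ?_⟩, Units.ext rfl⟩
  · change (d : Matrix (Fin 2) (Fin 2) K) * ((d⁻¹ : GL (Fin 2) K) : Matrix (Fin 2) (Fin 2) K) = 1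
    rw [← Units.val_mul, mul_inv_cancel, Units.val_one]
  · change ((d⁻¹ : GL (Fin 2) K) : Matrix (Fin 2) (Fin 2) K) * (d : Matrix (Fin 2) (Fin 2) K) = 1
    rw [← Units.val_mul, inv_mul_cancel, Units.val_one]

/-- `GL₂(algebraMap K 𝔸_K) = (gl 2 K).toAdelic` is injective. [folklore] -/
theorem glTwo_map_algebraMap_injective :
    Function.Injective (Matrix.GeneralLinearGroup.map (n := Fin 2) (algebraMap K (AdeleRing (𝓞 K) K))) := by
  haveI := nontrivial_adeleRing K
  intro a b h
  refine Units.ext (Matrix.ext fun i j => ?_)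
  have h6 : (Matrix.GeneralLinearGroup.map (algebraMap K (AdeleRing (𝓞 K) K)) a).val i j =
      (Matrix.GeneralLinearGroup.map (algebraMap K (AdeleRing (𝓞 K) K)) b).val i j := by rw [h]
  exact (algebraMap K (AdeleRing (𝓞 K) K)).injective h6

/-- **Rational units of the torus inside `ℝ_{>0} GL₂(K)` come from `ℝ_{>0} Eˣ`**: for a non-scalar
`γ ∈ GL₂(K)`, `E = C(γ)` and `w ∈ E_𝔸ˣ`, `glTwoTorusMap γ w ∈ ℝ_{>0} · GL₂(K)` iff `w ∈ ℝ_{>0} · Eˣ`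
(if the image is `a · d` with `a ∈ ℝ_{>0}` central and `d ∈ GL₂(K)` — central retraction of
`GL₂(𝔸_K)` — then `d` commutes with `γ`, so `d ∈ Eˣ`, and `w = a · d` by injectivity). Hence the
torus isomorphism carries `ℝ_{>0} Eˣ` onto `ℝ_{>0} GL₂(K) ∩ C(γ)` (Gelbart (1975), p. 155:
`Z_𝔸 B_F \ B_𝔸`). [cite: Gelbart1975, pp. 154–155] -/
theorem glTwoTorusMap_mem_quotientSubgroup_iff
    (hγ : (γ : Matrix (Fin 2) (Fin 2) K) ∉ (⊥ : Subalgebra K (Matrix (Fin 2) (Fin 2) K)))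
    (w : adelicUnits K Eγ) :
    glTwoTorusMap K γ w ∈ (AdelicGroupData.gl 2 K).quotientSubgroup ↔
      w ∈ (AdelicGroupData.units K Eγ).quotientSubgroup := by
  refine ⟨fun hw => ?_, fun hw => map_quotientSubgroup_glTwoTorusMap_le K γ ⟨w, hw, rfl⟩⟩
  -- write the image as `a * d`, `a ∈ ℝ_{>0}` central, `d ∈ GL₂(K)` (central retraction)
  obtain ⟨θ₀, -, hθA, hθa, hθγ⟩ := exists_centralRetraction_gl 2 K
  have hx := (AdelicGroupData.mem_quotientSubgroup_iff_of_centralRetraction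
    (AdelicGroupData.gl 2 K) θ₀ hθA hθa hθγ _).1 hw
  obtain ⟨(d : GL (Fin 2) K), hd⟩ := hx
  obtain ⟨t, ht⟩ := hθA (glTwoTorusMap K γ w)
  -- read everything in the concrete group `GL₂(𝔸_K)`
  let θ : GL (Fin 2) (AdeleRing (𝓞 K) K) →* GL (Fin 2) (AdeleRing (𝓞 K) K) := θ₀
  have hd' : Matrix.GeneralLinearGroup.map (algebraMap K (AdeleRing (𝓞 K) K)) d =
      (θ (glTwoTorusMap K γ w))⁻¹ * glTwoTorusMap K γ w := hd
  have ht' : θ (glTwoTorusMap K γ w) = posRealScalar 2 K t := ht.symm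
  have hax : posRealScalar 2 K t * Matrix.GeneralLinearGroup.map (algebraMap K (AdeleRing (𝓞 K) K)) d =
      glTwoTorusMap K γ w := by
    rw [hd', ht', mul_inv_cancel_left]
  -- `d` commutes with `γ`
  have hcomm : Matrix.GeneralLinearGroup.map (algebraMap K (AdeleRing (𝓞 K) K)) d * γ𝔸 =
      γ𝔸 * Matrix.GeneralLinearGroup.map (algebraMap K (AdeleRing (𝓞 K) K)) d := by
    have h1 : glTwoTorusMap K γ w ∈ Subgroup.centralizer ({γ𝔸} : Set (GL (Fin 2) (AdeleRing (𝓞 K) K))) := by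
      rw [← range_glTwoTorusMap_eq_centralizer K γ hγ]; exact ⟨w, rfl⟩
    have h2 : posRealScalar 2 K t ∈ Subgroup.center (GL (Fin 2) (AdeleRing (𝓞 K) K)) :=
      posRealScalar_mem_center 2 K t
    have h3 := Subgroup.mem_centralizer_iff.1 h1 _ (Set.mem_singleton _)
    rw [← hax] at h3
    have ha : γ𝔸 * posRealScalar 2 K t = posRealScalar 2 K t * γ𝔸 := Subgroup.mem_center_iff.1 h2 _
    have h5 : posRealScalar 2 K t * (γ𝔸 * Matrix.GeneralLinearGroup.map (algebraMap K (AdeleRing (𝓞 K) K)) d) =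
        posRealScalar 2 K t * (Matrix.GeneralLinearGroup.map (algebraMap K (AdeleRing (𝓞 K) K)) d * γ𝔸) := by
      calc posRealScalar 2 K t * (γ𝔸 * Matrix.GeneralLinearGroup.map (algebraMap K (AdeleRing (𝓞 K) K)) d)
          = γ𝔸 * posRealScalar 2 K t * Matrix.GeneralLinearGroup.map (algebraMap K (AdeleRing (𝓞 K) K)) d := by
            rw [ha, mul_assoc]
        _ = γ𝔸 * (posRealScalar 2 K t * Matrix.GeneralLinearGroup.map (algebraMap K (AdeleRing (𝓞 K) K)) d) := by
            rw [mul_assoc]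
        _ = posRealScalar 2 K t * Matrix.GeneralLinearGroup.map (algebraMap K (AdeleRing (𝓞 K) K)) d * γ𝔸 := h3
        _ = posRealScalar 2 K t * (Matrix.GeneralLinearGroup.map (algebraMap K (AdeleRing (𝓞 K) K)) d * γ𝔸) := by
            rw [mul_assoc]
    exact (mul_left_cancel h5).symm
  have hcommK : d * γ = γ * d :=
    glTwo_map_algebraMap_injective K (by rw [map_mul, map_mul, hcomm])
  -- so `d ∈ Eˣ`
  obtain ⟨d', hd''⟩ := exists_units_centralizer_eq_of_commute K γ d hcommK
  -- hence `w = a · d'` by injectivity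
  have hw2 : w = posRealCentral K Eγ t * inclAdelic K Eγ d' := glTwoTorusMap_injective K γ (by
    rw [map_mul, glTwoTorusMap_posRealCentral, glTwoTorusMap_inclAdelic, hd'', ← hax])
  rw [hw2]
  change posRealCentral K Eγ t * inclAdelic K Eγ d' ∈ (posRealCentral K Eγ).range ⊔ (inclAdelic K Eγ).range
  exact Subgroup.mul_mem_sup ⟨t, rfl⟩ ⟨d', rfl⟩

/-! ### Keyed on the adelic group data -/

/-- **The torus isomorphism keyed on the adelic group data**: for a non-scalar `γ ∈ GL₂(K)` with
`E = C(γ)`, `E_𝔸ˣ ≃ₜ* C_{GL₂(𝔸_K)}(γ)` with `GL₂(𝔸_K)`, `γ` spelled through `AdelicGroupData.gl 2 K`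
(as in the trace formula). [cite: Gelbart1975, p. 154] -/
def glTwoDatumTorusEquiv
    (hγ : (γ : Matrix (Fin 2) (Fin 2) K) ∉ (⊥ : Subalgebra K (Matrix (Fin 2) (Fin 2) K))) :
    (AdelicGroupData.units K Eγ).Adelic ≃ₜ*
      Subgroup.centralizer ({(AdelicGroupData.gl 2 K).toAdelic γ} : Set (AdelicGroupData.gl 2 K).Adelic) :=
  glTwoTorusEquiv K γ hγ

/-- `glTwoDatumTorusEquiv w = glTwoTorusMap w` on underlying elements (definitional). [folklore] -/
@[simp]
theorem coe_glTwoDatumTorusEquiv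
    (hγ : (γ : Matrix (Fin 2) (Fin 2) K) ∉ (⊥ : Subalgebra K (Matrix (Fin 2) (Fin 2) K)))
    (w : (AdelicGroupData.units K Eγ).Adelic) :
    ((glTwoDatumTorusEquiv K γ hγ w : Subgroup.centralizer
        ({(AdelicGroupData.gl 2 K).toAdelic γ} : Set (AdelicGroupData.gl 2 K).Adelic)) :
      (AdelicGroupData.gl 2 K).Adelic) = glTwoTorusMap K γ w := rfl

/-- **`glTwoDatumTorusEquiv` carries `ℝ_{>0} Eˣ` onto `ℝ_{>0} GL₂(K) ∩ C(γ)`**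
(`glTwoTorusMap_mem_quotientSubgroup_iff`). [cite: Gelbart1975, pp. 154–155] -/
theorem glTwoDatumTorusEquiv_mem_iff
    (hγ : (γ : Matrix (Fin 2) (Fin 2) K) ∉ (⊥ : Subalgebra K (Matrix (Fin 2) (Fin 2) K)))
    (w : (AdelicGroupData.units K Eγ).Adelic) :
    glTwoDatumTorusEquiv K γ hγ w ∈ ((AdelicGroupData.gl 2 K).quotientSubgroup ⊓
        Subgroup.centralizer ({(AdelicGroupData.gl 2 K).toAdelic γ} :
          Set (AdelicGroupData.gl 2 K).Adelic)).subgroupOf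
          (Subgroup.centralizer ({(AdelicGroupData.gl 2 K).toAdelic γ} :
            Set (AdelicGroupData.gl 2 K).Adelic)) ↔
      w ∈ (AdelicGroupData.units K Eγ).quotientSubgroup := by
  rw [Subgroup.mem_subgroupOf, Subgroup.mem_inf]
  constructor
  · intro h
    exact (glTwoTorusMap_mem_quotientSubgroup_iff K γ hγ w).1 h.1
  · intro h
    exact ⟨(glTwoTorusMap_mem_quotientSubgroup_iff K γ hγ w).2 h, (glTwoDatumTorusEquiv K γ hγ w).2⟩

/-! ### Elliptic `γ`: compactness of `C(γ) ⧸ (ℝ_{>0} GL₂(K) ∩ C(γ))` -/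

/-- **Compactness of `C(γ) ⧸ (ℝ_{>0} GL₂(K) ∩ C(γ))` for an elliptic `γ ∈ GL₂(K)`** (irreducible
characteristic polynomial): `E = C(γ) = K[γ]` is then a quadratic field
(`forall_isUnit_centralizer_of_irreducible_charpoly`), `E_𝔸ˣ ⧸ ℝ_{>0} Eˣ` is compact by
Fujisaki's lemma (`compactSpace_automorphicQuotient_units_of_forall_isUnit`), and the quotient in
the statement is its continuous image under the map induced by the torus homomorphism (onto
`C(γ)`, mapping `ℝ_{>0} Eˣ` into `ℝ_{>0} GL₂(K)`). This is the finiteness of the volume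
`meas(Z_𝔸 B_F \ B_𝔸)` of an elliptic term of the trace formula (10.15) (Gelbart (1975), p. 155).
For a hyperbolic (split) `γ` the statement fails — those classes do not occur in (10.15).
[cite: Gelbart1975, p. 155] -/
theorem compactSpace_glTwo_centralizer_quotient
    (hγ : Irreducible (γ : Matrix (Fin 2) (Fin 2) K).charpoly) :
    CompactSpace (↥(Subgroup.centralizer ({(AdelicGroupData.gl 2 K).toAdelic γ} :
        Set (AdelicGroupData.gl 2 K).Adelic)) ⧸
      ((AdelicGroupData.gl 2 K).quotientSubgroup ⊓
        Subgroup.centralizer ({(AdelicGroupData.gl 2 K).toAdelic γ} :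
          Set (AdelicGroupData.gl 2 K).Adelic)).subgroupOf
        (Subgroup.centralizer ({(AdelicGroupData.gl 2 K).toAdelic γ} :
          Set (AdelicGroupData.gl 2 K).Adelic))) := by
  have hγ' : (γ : Matrix (Fin 2) (Fin 2) K) ∉ (⊥ : Subalgebra K (Matrix (Fin 2) (Fin 2) K)) :=
    not_mem_bot_of_irreducible_charpoly hγ
  let Gγ : Subgroup (AdelicGroupData.gl 2 K).Adelic :=
    Subgroup.centralizer ({(AdelicGroupData.gl 2 K).toAdelic γ} : Set (AdelicGroupData.gl 2 K).Adelic)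
  let M : Subgroup Gγ := ((AdelicGroupData.gl 2 K).quotientSubgroup ⊓ Gγ).subgroupOf Gγ
  change CompactSpace (Gγ ⧸ M)
  -- `E` is a field: Fujisaki for `E`
  haveI : Nontrivial Eγ := ⟨⟨0, 1, fun h => zero_ne_one (congrArg Subtype.val h)⟩⟩
  have hc : CompactSpace (AdelicGroupData.units K Eγ).automorphicQuotient :=
    AdelicGroupData.compactSpace_automorphicQuotient_units_of_forall_isUnit K Eγ
      (forall_isUnit_centralizer_of_irreducible_charpoly hγ)
  haveI : CompactSpace (adelicUnits K Eγ ⧸ (AdelicGroupData.units K Eγ).quotientSubgroup) := hc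
  have hmem : ∀ w, glTwoTorusMap K γ w ∈ Gγ := fun w => by
    change glTwoTorusMap K γ w ∈ Subgroup.centralizer ({γ𝔸} : Set (GL (Fin 2) (AdeleRing (𝓞 K) K)))
    rw [← range_glTwoTorusMap_eq_centralizer K γ hγ']
    exact ⟨w, rfl⟩
  -- `φ' : E_𝔸ˣ → G_γ`, continuous and onto
  let φ' : adelicUnits K Eγ → Gγ := fun w => ⟨glTwoTorusMap K γ w, hmem w⟩
  have hφ'c : Continuous φ' := (continuous_glTwoTorusMap K γ).subtype_mk _
  have hφ's : Function.Surjective φ' := by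
    rintro ⟨g, hg⟩
    have hg' : g ∈ (glTwoTorusMap K γ).range := by
      rw [range_glTwoTorusMap_eq_centralizer K γ hγ']; exact hg
    obtain ⟨w, rfl⟩ := hg'
    exact ⟨w, rfl⟩
  -- the induced map on the quotients
  have hcompat : ∀ a b : adelicUnits K Eγ,
      QuotientGroup.leftRel (AdelicGroupData.units K Eγ).quotientSubgroup a b →
        QuotientGroup.leftRel M (φ' a) (φ' b) := by
    intro a b hab
    rw [QuotientGroup.leftRel_apply] at hab ⊢
    refine Subgroup.mem_subgroupOf.2 (Subgroup.mem_inf.2 ⟨?_, Gγ.mul_mem (Gγ.inv_mem (φ' a).2) (φ' b).2⟩)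
    change (glTwoTorusMap K γ a)⁻¹ * glTwoTorusMap K γ b ∈ (AdelicGroupData.gl 2 K).quotientSubgroup
    rw [← map_inv, ← map_mul]
    exact map_quotientSubgroup_glTwoTorusMap_le K γ ⟨a⁻¹ * b, hab, rfl⟩
  let ψ : adelicUnits K Eγ ⧸ (AdelicGroupData.units K Eγ).quotientSubgroup → Gγ ⧸ M :=
    Quotient.map' φ' hcompat
  have hψc : Continuous ψ := by
    have hq : IsOpenQuotientMap (QuotientGroup.mk : (AdelicGroupData.units K Eγ).Adelic →
        (AdelicGroupData.units K Eγ).Adelic ⧸ (AdelicGroupData.units K Eγ).quotientSubgroup) :=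
      QuotientGroup.isOpenQuotientMap_mk
    have h : Continuous (ψ ∘ (QuotientGroup.mk : (AdelicGroupData.units K Eγ).Adelic →
        (AdelicGroupData.units K Eγ).Adelic ⧸ (AdelicGroupData.units K Eγ).quotientSubgroup)) :=
      (QuotientGroup.continuous_mk (N := M)).comp hφ'c
    exact hq.continuous_comp_iff.1 h
  have hψs : Function.Surjective ψ := by
    intro q
    induction q using QuotientGroup.induction_on with
    | H g =>
      obtain ⟨w, rfl⟩ := hφ's g
      exact ⟨QuotientGroup.mk w, rfl⟩
  exact hψs.compactSpace hψc

end Torus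

end Literature.NumberTheory.Automorphic
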